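import Literature.AlgebraicGeometry.Frobenioids.Thm49SubII
import Literature.AlgebraicGeometry.Frobenioids.Thm49TwinPrimaryExistence
import Literature.AlgebraicGeometry.Frobenioids.Thm49FunctorialPullbacks
import Literature.AlgebraicGeometry.Frobenioids.Thm49FunctorialBaseIsos
import Literature.AlgebraicGeometry.Frobenioids.Thm49StrictlyRationalWLOG
import Literature.AlgebraicGeometry.Frobenioids.Thm49IsotropicWLOG
import HarnessLib

/-!
# [FrdI] Theorem 4.9 sub-DAG (S5), statements part II — closers

Mochizuki, *The geometry of Frobenioids I: the general theory*, Kyushu J. Math. **62** (2008)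
293–400, §4, Theorem 4.9, proof pp. 89–90 [cite: MochizukiFrdI2008, Thm. 4.9 p.89].

PROOF-ONLY file (collector: seat abc-iut-w5-d021, one writer of `Thm49SubII.lean`): the `…_holds`
witnesses of named statements of `Thm49SubII.lean`, each a one-line application of the proof file that
carries the mathematics —
* `twinPrimaryFromCartesianSquares_holds` (row T49-L07, existence half; seat abc-iut-w5-d021:
  `PreFrobenioid.exists_twinPrimary_squares_of_isStrictlyRational`, `Thm49TwinPrimaryExistence.lean`);
* `functorialOnBaseIsos_holds` (row T49-L03, functoriality clause; seat abc-iut-w4-d035: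
  `FrdI.T49.functorialBaseIsos`, `Thm49FunctorialBaseIsos.lean`);
* `functorialPullbacks_holds` (row T49-L04; seat abc-iut-w4-d035:
  `PreFrobenioid.pull_natural_of_isPullbackMorphism`, `Thm49FunctorialPullbacks.lean`);
* `perfectStrictlyRationalWLOG_holds` (row T49-L05; seat abc-iut-w4-d109:
  `FrdI.T49.leftHand_of_leftHand_of_isPullbackMorphism`, `Thm49StrictlyRationalWLOG.lean`);
* `isotropicNonGroupLikeWLOG_holds` (row T49-L01; seat abc-iut-w4-d109:
  `FrdI.T49.nonempty_divisorMonoidIsoOver_of_isotropic`, `Thm49IsotropicWLOG.lean`).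
`SubsetPhiPreserved` (row T49-L03, bijection clause) is closed by its holder's chain (not here).
No new definitions; nothing here bears on [IUTchIII] Cor. 3.12.
-/

namespace Literature.AlgebraicGeometry.Frobenioids

open CategoryTheory Opposite

namespace FrdI.T49

universe w v v' u u'

/-- **Row T49-L07 `TwinPrimaryFromCartesianSquares` (existence half) HOLDS**: for a Frobenioid of
perfect and isotropic type with `Φ` perf-factorial, a strictly rational object (Def. 4.5 (ii) at THE
birationalization, any support predicate obeying the support axiom) carries at every prime the
twin-primary pair of Prop. 4.1 (iii) squares ([FrdI] p. 90 ll. 5–27) — by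
`PreFrobenioid.exists_twinPrimary_squares_of_isStrictlyRational` (seat abc-iut-w5-d021).
[cite: MochizukiFrdI2008, Thm. 4.9 p.90] -/
theorem twinPrimaryFromCartesianSquares_holds : TwinPrimaryFromCartesianSquares.{w, v, v', u, u'} :=
  fun _ hF hsq hperf histr hpf Supp hSupp _ hA 𝔭 =>
    PreFrobenioid.exists_twinPrimary_squares_of_isStrictlyRational hF hsq hperf histr hpf Supp hSupp hA 𝔭

/-- **Row T49-L03, functoriality clause `FunctorialOnBaseIsos` HOLDS** ([FrdI] p. 89 ll. 31–33) — by
seat abc-iut-w4-d035's `FrdI.T49.functorialBaseIsos` (`Thm49FunctorialBaseIsos.lean`).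
[cite: MochizukiFrdI2008, Thm. 4.9 p.89] -/
theorem functorialOnBaseIsos_holds : FunctorialOnBaseIsos.{w, v, v', u, u'} :=
  fun _ _ _ S m hm _ _ φ hφ z => functorialBaseIsos S m hm φ hφ z

/-- **Row T49-L04 `FunctorialPullbacks` HOLDS** ([FrdI] p. 89 ll. 33–36, "by pulling back pre-steps,
as in Proposition 1.11, (v)") — by seat abc-iut-w4-d035's `PreFrobenioid.pull_natural_of_isPullbackMorphism`
(`Thm49FunctorialPullbacks.lean`). [cite: MochizukiFrdI2008, Thm. 4.9 p.89] -/
theorem functorialPullbacks_holds : FunctorialPullbacks.{w, v, v', u, u'} :=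
  fun _ _ Ψ S m hm _ _ φ hφ x =>
    PreFrobenioid.pull_natural_of_isPullbackMorphism S.isFrobenioid₁ S.isFrobenioid₂ Ψ.functor
      S.pullback_map m hm φ hφ x

/-- **Row T49-L05 `PerfectStrictlyRationalWLOG` HOLDS** ([FrdI] p. 89 ll. 38–46: the left-hand property
transports along a pull-back morphism `ψ : A′ → A` — "we may assume without loss of generality that `A` is
strictly rational") — by seat abc-iut-w4-d109's `FrdI.T49.leftHand_of_leftHand_of_isPullbackMorphism`
(`Thm49StrictlyRationalWLOG.lean`; route of seat abc-iut-w4-d105). [cite: MochizukiFrdI2008, Thm. 4.9 p.89] -/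
theorem perfectStrictlyRationalWLOG_holds : PerfectStrictlyRationalWLOG.{w, v, v', u, u'} :=
  fun F₁ F₂ Ψ S _ _ ψ hψ m' m hm' hm hleft =>
    leftHand_of_leftHand_of_isPullbackMorphism F₁ F₂ Ψ S ψ hψ m' m hm' hm hleft

/-- **Row T49-L01 `IsotropicNonGroupLikeWLOG` HOLDS** ([FrdI] p. 89 ll. 3–5: an isomorphism of functors
`Φ₁ ⥲ Φ₂` over `Ψ` given on the isotropic objects extends to all of `C₁` along the isotropic hulls — "we
may assume without loss of generality that `C₁`, `C₂` are of isotropic type") — by seat abc-iut-w4-d109's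
`FrdI.T49.nonempty_divisorMonoidIsoOver_of_isotropic` (`Thm49IsotropicWLOG.lean`).
[cite: MochizukiFrdI2008, Thm. 4.9 p.89] -/
theorem isotropicNonGroupLikeWLOG_holds : IsotropicNonGroupLikeWLOG.{w, v, v', u, u'} :=
  fun F₁ F₂ Ψ hF₁ hF₂ hiso hhull m hm =>
    nonempty_divisorMonoidIsoOver_of_isotropic F₁ F₂ Ψ hF₁ hF₂ hiso hhull m hm

end FrdI.T49

end Literature.AlgebraicGeometry.Frobenioids
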